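import Literature.AlgebraicGeometry.Resolution.NormalAscent
import Literature.AlgebraicGeometry.Resolution.CohenMacaulayCatenary
import Summits.ResolutionOfSingularities.ResolutionOfSingularities.Theorems.FrobeniusLadderFRationalModificationSopWeaklyRegular
import Literature.RingTheory.TightClosure.TightClosure
import Mathlib.RingTheory.KrullDimension.Field
import HarnessLib

/-!
# Normal Noetherian local domains of dimension `≤ 2` are Cohen–Macaulay (Serre)

Support file for crux stmt-ResolutionOfSingularities-15315
(`FrobeniusLadder.FInjectiveMacaulayfication`, line `Sketch`, seat c5): stub
`stub_normalSurfaceSop` of package B (Kawasaki's Macaulayfication in dimension `≤ 2` is the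
normalization, because normal surfaces are Cohen–Macaulay).

Let `(R, 𝔪)` be a Noetherian local domain which is integrally closed (normal) and of Krull
dimension `d ≤ 2`. Then `R` has an `R`-regular sequence in `𝔪` of length `d`
(`exists_isRegular_length_eq_ringKrullDim_of_le_two`):

* `d = 0`: the empty sequence;
* `d = 1`: `𝔪 ≠ ⊥` (a field has dimension `0`), and any `a ∈ 𝔪 ∖ 0` is a nonzerodivisor;
* `d = 2`: if `R` is regular this is Matsumura Thm. 17.8
  (`Literature.AlgebraicGeometry.Resolution.exists_isRegular_length_eq_ringKrullDim`); otherwise,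
  for `a ∈ 𝔪 ∖ 0` the "depth `≥ 2`" step of Serre's criterion
  (`Literature.AlgebraicGeometry.Resolution.exists_mem_maximalIdeal_forall_mem_span`, Stacks 031S)
  supplies `b ∈ 𝔪` which is a nonzerodivisor on `R/aR`, so `(a, b)` is a regular sequence.

Hence (Matsumura Thm. 17.4 (iii), in tree as
`…Theorems.FRationalModification.SopWeaklyRegular.stub_sopWeaklyRegular`) every system of
parameters of `R` — `d` elements generating an ideal whose radical is maximal — is a weakly
regular sequence in the given order (`stub_normalSurfaceSop`).

References: H. Matsumura, *Commutative Ring Theory*, CUP 1986, Thm. 17.4 (iii), Thm. 17.8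
[Matsumura1987]; The Stacks Project, Tag 031S (Serre's criterion) [StacksProject].
-/

-- single-problem summit: the doubled namespace component is forced
set_option linter.dupNamespace false

namespace Summit.ResolutionOfSingularities.ResolutionOfSingularities.Theorems.FInjectiveMacaulayfication.NormalSurfaceSop

open IsLocalRing RingTheory.Sequence Literature.AlgebraicGeometry.Resolution

/-- In a local domain, a nonzero element of `𝔪` is a regular sequence of length one.
[folklore] -/
theorem isRegular_singleton {R : Type*} [CommRing R] [IsDomain R] [IsLocalRing R] {a : R}
    (ham : a ∈ maximalIdeal R) (ha0 : a ≠ 0) : IsRegular R [a] :=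
  IsRegular.of_isWeaklyRegular_of_mem_maximalIdeal (L := R) (by simpa using ham)
    (IsWeaklyRegular.cons (IsRegular.of_ne_zero ha0).left.isSMulRegular
      (IsWeaklyRegular.nil R _))

/-- In a local domain, if `a ∈ 𝔪 ∖ 0` and `b ∈ 𝔪` is a nonzerodivisor on `R/aR`
(`b y ∈ (a) → y ∈ (a)`), then `(a, b)` is a regular sequence. [folklore] -/
theorem isRegular_pair {R : Type*} [CommRing R] [IsDomain R] [IsLocalRing R] {a b : R}
    (ham : a ∈ maximalIdeal R) (ha0 : a ≠ 0) (hbm : b ∈ maximalIdeal R)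
    (hb : ∀ y : R, b * y ∈ Ideal.span {a} → y ∈ Ideal.span {a}) : IsRegular R [a, b] := by
  refine IsRegular.of_isWeaklyRegular_of_mem_maximalIdeal (L := R) ?_
    (IsWeaklyRegular.cons (IsRegular.of_ne_zero ha0).left.isSMulRegular
      (IsWeaklyRegular.cons (isSMulRegular_quotSMulTop_of_forall hb) (IsWeaklyRegular.nil R _)))
  intro r hr
  simp only [List.mem_cons, List.not_mem_nil, or_false] at hr
  rcases hr with rfl | rfl
  exacts [ham, hbm]

/-- **Serre: a normal Noetherian local domain of dimension `≤ 2` is Cohen–Macaulay** — it has a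
regular sequence in `𝔪` of length `dim R`: `d = 0` the empty sequence, `d = 1` any `a ∈ 𝔪 ∖ 0`,
`d = 2` either Matsumura Thm. 17.8 (regular case) or `(a, b)` with `b` from the depth-`≥ 2` step
of Serre's criterion (Stacks 031S). [cite: Matsumura1987, Thm. 17.4] -/
theorem exists_isRegular_length_eq_ringKrullDim_of_le_two (R : Type) [CommRing R]
    [NoZeroDivisors R] [IsNoetherianRing R] [IsLocalRing R] [IsIntegrallyClosed R]
    {d : ℕ} (hd2 : d ≤ 2) (hd : ringKrullDim R = d) :
    ∃ rs : List R, IsRegular R rs ∧ (∀ r ∈ rs, r ∈ maximalIdeal R) ∧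
      (rs.length : WithBot ℕ∞) = ringKrullDim R := by
  haveI : IsDomain R := NoZeroDivisors.to_isDomain R
  -- in positive dimension the maximal ideal has a nonzero element
  have hm : d ≠ 0 → ∃ a ∈ maximalIdeal R, a ≠ 0 := by
    intro hd0
    refine Submodule.exists_mem_ne_zero_of_ne_bot fun h => hd0 ?_
    have h0 := ringKrullDim_eq_zero_of_isField (isField_iff_maximalIdeal_eq.mpr h)
    rw [hd] at h0
    exact_mod_cast h0
  rcases Nat.le_succ_iff.mp hd2 with hd1 | rfl
  · rcases Nat.le_succ_iff.mp hd1 with hd0 | rfl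
    · -- `d = 0`
      obtain rfl : d = 0 := Nat.le_zero.mp hd0
      exact ⟨[], IsRegular.nil R R, fun r hr => by simp at hr, by rw [hd]; rfl⟩
    · -- `d = 1`
      obtain ⟨a, ham, ha0⟩ := hm one_ne_zero
      exact ⟨[a], isRegular_singleton ham ha0, fun r hr => by simp_all, by rw [hd]; rfl⟩
  · -- `d = 2`
    by_cases hreg : IsRegularLocalRing R
    · exact exists_isRegular_length_eq_ringKrullDim R
    obtain ⟨a, ham, ha0⟩ := hm two_ne_zero
    obtain ⟨b, hbm, hb⟩ := exists_mem_maximalIdeal_forall_mem_span hreg ham ha0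
    refine ⟨[a, b], isRegular_pair ham ha0 hbm hb, fun r hr => ?_, by rw [hd]; rfl⟩
    simp only [List.mem_cons, List.not_mem_nil, or_false] at hr
    rcases hr with rfl | rfl
    exacts [ham, hbm]

/-- **B1, every system of parameters of a normal surface singularity is a regular sequence**:
for a Noetherian, integrally closed local domain `R` of Krull dimension `d ≤ 2`, every
`s : Fin d → R` generating an ideal whose radical is maximal (a system of parameters) is a weakly
regular sequence on `R` in the given order — Serre (normal of dimension `≤ 2` ⇒ Cohen–Macaulay,
Stacks 031S) combined with Matsumura Thm. 17.4 (iii) (in a Cohen–Macaulay local ring every system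
of parameters is a regular sequence). [cite: Matsumura1987, Thm. 17.4] -/
theorem stub_normalSurfaceSop : ∀ (R : Type) [CommRing R] [NoZeroDivisors R] [IsNoetherianRing R] [IsLocalRing R]
    [IsIntegrallyClosed R], ringKrullDim R ≤ 2 → ∀ d : ℕ, ringKrullDim R = d → ∀ s : Fin d → R,
      (Ideal.span (Set.range s)).radical.IsMaximal → RingTheory.Sequence.IsWeaklyRegular R (List.ofFn s) := by
  intro R _ _ _ _ _ h2 d hd s hrad
  have hd2 : d ≤ 2 := by
    rw [hd] at h2
    exact_mod_cast h2
  exact FRationalModification.SopWeaklyRegular.stub_sopWeaklyRegular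
    (exists_isRegular_length_eq_ringKrullDim_of_le_two R hd2 hd) s
    (Literature.RingTheory.TightClosure.isSystemOfParameters_iff.mpr ⟨hd, hrad⟩)

end Summit.ResolutionOfSingularities.ResolutionOfSingularities.Theorems.FInjectiveMacaulayfication.NormalSurfaceSop
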